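import Mathlib.MeasureTheory.Integral.Prod
import Mathlib.MeasureTheory.Integral.IntervalIntegral.Periodic
import Mathlib.Analysis.SpecialFunctions.Integrals.Basic
import Literature.MathematicalPhysics.QuantumLattice.LiebWuBetheAnsatzProofs
import Literature.Analysis.FunctionSpaces.BesselJPoissonIntegral
import Literature.Analysis.FunctionSpaces.LiebWuIntegralsProofs
import HarnessLib

/-!
# The Lieb–Wu momentum density `ρ₀` and the energy of the half-filled band (node F3 refined)

Family `hubbard` (trunk T-QLATTICE), statement hubbard.S10 (`Literature.MathematicalPhysics.QuantumLattice.lieb_wu`).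
`LiebWuBetheAnsatz.lean` decomposes `lieb_wu` into the named facts F1–F5b; after the discharges
recorded there and in `LiebWuBetheAnsatzProofs.lean` the remaining hypotheses of
`lieb_wu_of_goldbaum'` are F2c (the Bethe state is the ground state of its sector, Goldbaum 2005
§4), F3 (`liebWu_betheEnergy_tendsto`: the Bethe energies per site of ANY family of ground-state
roots on the rings of `4m + 2` sites tend to `liebWuEnergy U`; Goldbaum 2005 §5 with Lieb–Wu
2003 §6) and F5b (Lieb–Wu's `μ₋`, no printed proof). This file splits F3 along the printed proof
into

* **F3a** (`goldbaum_rootDensity_tendsto`, named fact): the empirical distribution of the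
  momenta `k_j` of ground-state roots converges to Lieb–Wu's density `ρ₀(k) dk` on `[-π, π]`
  (Goldbaum, CMP 258 (2005) 317, §5, eq. (5.16): "the set of `k`-s converge to a distribution
  `ρ(k)` on the interval `[-π, π]` ... given by the solution ... obtained in [LW1]"), and
* **F3c** (PROVED, `liebWuEnergy_eq_integral_cos_mul_liebWuRho0`): "The substitution of
  (`ρ₀`) into `E(M, M') = -2 N_a ∫_{-Q}^{Q} ρ(k) cos k dk` finally yields the ground state
  energy `E₀(N_a/2, N_a/2) = -4 N_a ∫₀^∞ J₀(ω) J₁(ω) / (ω (1 + e^{ωU/2})) dω`" (Lieb–Wu, Physica A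
  321 (2003) 1, §6, boxed formulas for `ρ₀` and `E₀`; PRL 20 (1968) 1445, eqs. (17), (19), (20)),
  i.e. `-2 ∫_{-π}^{π} ρ₀(k) cos k dk = liebWuEnergy U` for `U > 0`,

and PROVES the glue `liebWu_betheEnergy_tendsto_of_rootDensity : F3a → F3` (test F3a against
`cos`) and the assembly `lieb_wu_of_rootDensity : F2c → F3a → F5b → lieb_wu`. It also proves
the normalisation `∫_{-π}^{π} ρ₀ = 1` (Lieb–Wu 2003, proof of Theorem 3: "When `Q = π`, we see
from (`ρ`) that `∫_{-Q}^{Q} ρ = ∫_{-π}^{π} 1/2π = 1`").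

## The proof of F3c

`ρ₀(k) = 1/(2π) + (cos k/π) ∫₀^∞ cos(ω sin k) J₀(ω)/(1 + e^{ωU/2}) dω`. The integrand is jointly
continuous and dominated by `e^{-ωU/2}` (`|J₀| ≤ 1`), so for `U > 0` Fubini applies on
`[-π, π] × (0, ∞)` (`MeasureTheory.intervalIntegral_integral_swap`):
`∫_{-π}^{π} cos k ρ₀(k) dk = 0 + π⁻¹ ∫₀^∞ J₀(ω)/(1 + e^{ωU/2}) (∫_{-π}^{π} cos²k cos(ω sin k) dk) dω`,
and `ω ∫_{-π}^{π} cos²k cos(ω sin k) dk = 2π J₁(ω)` (`mul_integral_cos_sq_mul_cos_mul_sin`): the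
integrand has period `π`, so the integral is twice `∫₀^π`, which after `k = θ - π/2` is Poisson's
integral `ω ∫₀^π cos(ω cos θ) sin²θ dθ = π J₁(ω)`
(`Literature.Analysis.FunctionSpaces.mul_integral_cos_mul_cos_mul_sin_sq_eq_pi_mul_besselJ_one`; Lieb–Wu 2003 §6
quote `J₁(ω) = ω π⁻¹ ∫₀^π cos(ω sin p) cos²p dp`). Hence
`∫_{-π}^{π} cos k ρ₀(k) dk = 2 ∫₀^∞ J₀J₁/(ω(1 + e^{ωU/2})) dω` and `-2 ∫ cos ρ₀ = liebWuEnergy U`.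

## Rigour status

F3a is a theorem in print (Goldbaum 2005, §5: the step densities `ρ_i` of the roots are
uniformly bounded, a subsequence converges weakly in `L²` and then pointwise and strongly in `L¹`
to a solution of the Lieb–Wu integral equations, unique at half filling by Lieb–Wu 2003, §5,
Theorem 1, hence the whole sequence converges; testing against a continuous `g` follows because
the cell masses are `1/N_a`). Only the `k`-part (5.16) is vendored; the `Λ`-part (5.17) is not
needed for `lieb_wu`. After this file the trust base of part (i) of `lieb_wu` is {F2c, F3a}; part
(ii) still rests on F5b, which has no printed proof (see `LiebWuBetheAnsatz`).

## Design notes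

* `liebWuRho0Integrand U k ω = cos(ω sin k) J₀(ω) / (1 + e^{ωU/2})` is named so that the Fubini
  and domination lemmas have clean statements; `liebWuRho0` unfolds to the boxed formula by `rfl`.
  Both make sense for every real `U` (Bochner integral); for `U > 0` no junk value arises
  (`integrableOn_liebWuRho0Integrand`).
* F3a is stated with test functions (`∀ g` continuous, `(1/N_a) Σ_j g(k_j) → ∫_{-π}^{π} g ρ₀`)
  rather than with `MeasureTheory.ProbabilityMeasure`, avoiding any positivity claim about `ρ₀`
  (Lieb–Wu 2003, Lemma 5, not needed here).
* Mathlib: `Function.Periodic.intervalIntegral_add_eq`, `intervalIntegral.integral_comp_add_right`,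
  `MeasureTheory.intervalIntegral_integral_swap`, `MeasureTheory.Integrable.mono'`,
  `MeasureTheory.Integrable.mul_prod`, `integral_cos`; Bessel functions are the Literature ones
  (`Literature.Analysis.FunctionSpaces.besselJ`, Mathlib has none).

## Sources

* E. H. Lieb, F. Y. Wu, *The one-dimensional Hubbard model: a reminiscence*, Physica A 321 (2003)
  1–27 = arXiv:cond-mat/0207529 (held; key `LiebWuPhysicaA2003`): §4 eq. for `E(M,M')`
  (`-2N_a ∫ρ cos k`), §6 boxed `ρ₀(k)`, boxed `E₀(N_a/2,N_a/2)`, the integral representations of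
  `J₀`, `J₁` quoted there; §5 proof of Theorem 3 (`∫_{-π}^{π} ρ = 1` at `Q = π`).
* E. H. Lieb, F. Y. Wu, PRL 20 (1968) 1445 (key `LiebWuPRL1968`; read in A. Montorsi (ed.), *The
  Hubbard Model*, World Scientific 1992, pp. 63–68): eqs. (17), (19), (20).
* P. S. Goldbaum, CMP 258 (2005) 317–337 = arXiv:cond-mat/0403736 (held; key `Goldbaum2005`):
  §5, eqs. (5.1)–(5.17), in particular (5.16).
-/

noncomputable section

open Filter Finset MeasureTheory Set Real intervalIntegral
open Literature.Analysis.FunctionSpaces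
open scoped Topology BigOperators

namespace Literature.MathematicalPhysics.QuantumLattice

/-! ### Lieb–Wu's momentum density at half filling -/

/-- The integrand `cos(ω sin k) J₀(ω) / (1 + e^{ωU/2})` of Lieb–Wu's momentum density `ρ₀(k)` of
the half-filled band. Lieb–Wu, Physica A 321 (2003) 1, §6, boxed formula for `ρ₀(k)`; PRL 20
(1968) 1445, eq. (19). [cite: LiebWuPhysicaA2003, §6, formula for ρ₀(k)] -/
def liebWuRho0Integrand (U k ω : ℝ) : ℝ :=
  Real.cos (ω * Real.sin k) * besselJ 0 ω / (1 + Real.exp (ω * U / 2))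

/-- **Lieb–Wu's momentum density of the half-filled Hubbard chain** (`B = ∞`, `Q = π`):
`ρ₀(k) = 1/(2π) + (cos k / π) ∫₀^∞ cos(ω sin k) J₀(ω) / (1 + e^{ωU/2}) dω`, the density of the
Bethe momenta `k_j` in the thermodynamic limit. Lieb–Wu, Physica A 321 (2003) 1, §6, boxed
formula for `ρ₀(k)`; PRL 20 (1968) 1445, eq. (19); Goldbaum, CMP 258 (2005) 317, eq. (5.16).
[cite: LiebWuPhysicaA2003, §6, formula for ρ₀(k)] -/
def liebWuRho0 (U k : ℝ) : ℝ :=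
  1 / (2 * π) + Real.cos k / π * ∫ ω in Ioi (0 : ℝ), liebWuRho0Integrand U k ω

/-- `liebWuRho0` unfolded to the boxed formula of Lieb–Wu 2003, §6. [cite: LiebWuPhysicaA2003, §6, formula for ρ₀(k)] -/
theorem liebWuRho0_eq (U k : ℝ) :
    liebWuRho0 U k = 1 / (2 * π) + Real.cos k / π *
      ∫ ω in Ioi (0 : ℝ), Real.cos (ω * Real.sin k) * besselJ 0 ω / (1 + Real.exp (ω * U / 2)) :=
  rfl

/-! ### F3a: convergence of the root distribution (Goldbaum 2005, §5) -/

/-- **F3a (thermodynamic limit of the Bethe momenta at half filling; Goldbaum 2005, §5).** For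
`U > 0` and ANY family of ground-state roots of the Lieb–Wu equations on the rings of
`N_a = 4m + 2` sites at half filling (`IsLiebWuGroundRoots U m (k m) (Λ m)`), the empirical
distribution `(1/N_a) Σ_j δ_{k_j}` of the momenta converges, as `m → ∞`, to `ρ₀(k) dk` on
`[-π, π]`: for every continuous test function `g`,
`(1/(4m+2)) Σ_j g(k_j) → ∫_{-π}^{π} g(k) ρ₀(k) dk`. Printed proof: the step densities of the
roots are uniformly bounded; a subsequence converges weakly in `L²`, then pointwise and strongly
in `L¹`, to densities solving the Lieb–Wu integral equations (5.10)–(5.11), whose solution at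
half filling is unique (Lieb–Wu 2003, §5, Theorem 1) and equal to `ρ₀`, `σ₀`; hence the whole
sequence converges (Goldbaum, eq. (5.16)). Only the `k`-part is vendored (the `Λ`-part, eq.
(5.17), is not needed for `lieb_wu`). Goldbaum, CMP 258 (2005) 317, §5, eqs. (5.1)–(5.16);
Lieb–Wu, Physica A 321 (2003) 1, §5 Theorem 1, §6. [cite: Goldbaum2005, §5, eq. (5.16)]
[cite: LiebWuPhysicaA2003, §5 Theorem 1 and §6] -/
def goldbaum_rootDensity_tendsto : Prop :=
  ∀ (U : ℝ) (_hU : 0 < U) (k : ∀ m : ℕ, Fin (4 * m + 2) → ℝ) (Λ : ∀ m : ℕ, Fin (2 * m + 1) → ℝ)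
    (_hk : ∀ m, IsLiebWuGroundRoots U m (k m) (Λ m)) (g : ℝ → ℝ) (_hg : Continuous g),
    Tendsto (fun m : ℕ => (∑ j, g (k m j)) / (4 * m + 2 : ℝ)) atTop
      (𝓝 (∫ x in (-π)..π, g x * liebWuRho0 U x))

/-! ### The `cos²`-moment of `cos(ω sin k)`: Poisson's integral for `J₁` on the full period -/

/-- `ω ∫_{-π}^{π} cos²k cos(ω sin k) dk = 2π J₁(ω)`: the integrand has period `π`, so the integral
is `2 ∫₀^π`, and `k = θ - π/2` turns it into Poisson's integral `ω ∫₀^π cos(ω cos θ) sin²θ dθ =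
π J₁(ω)`. Lieb–Wu, Physica A 321 (2003) 1, §6 (`J₁(ω) = ω π⁻¹ ∫₀^π cos(ω sin p) cos²p dp`) and
§7.1 (`2 ∫₀^{π/2} cos(ω sin θ) cos²θ dθ = (π/ω) J₁(ω)`). [cite: LiebWuPhysicaA2003, §6, integral representation of J₁] -/
theorem mul_integral_cos_sq_mul_cos_mul_sin (ω : ℝ) :
    ω * ∫ x in (-π)..π, Real.cos x ^ 2 * Real.cos (ω * Real.sin x) = 2 * π * besselJ 1 ω := by
  have hper : Function.Periodic (fun x : ℝ => Real.cos x ^ 2 * Real.cos (ω * Real.sin x)) π :=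
    fun x => by simp only [Real.cos_add_pi, Real.sin_add_pi, neg_sq, mul_neg, Real.cos_neg]
  have hper' : Function.Periodic (fun θ : ℝ => Real.cos (ω * Real.cos θ) * Real.sin θ ^ 2) π :=
    fun θ => by simp only [Real.cos_add_pi, Real.sin_add_pi, neg_sq, mul_neg, Real.cos_neg]
  have hcont : Continuous fun x : ℝ => Real.cos x ^ 2 * Real.cos (ω * Real.sin x) := by fun_prop
  have h1 : ∫ x in (-π)..π, Real.cos x ^ 2 * Real.cos (ω * Real.sin x) =
      (∫ x in (-π)..0, Real.cos x ^ 2 * Real.cos (ω * Real.sin x)) +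
        ∫ x in (0 : ℝ)..π, Real.cos x ^ 2 * Real.cos (ω * Real.sin x) :=
    (integral_add_adjacent_intervals (hcont.intervalIntegrable _ _)
      (hcont.intervalIntegrable _ _)).symm
  have h2 : ∫ x in (-π)..0, Real.cos x ^ 2 * Real.cos (ω * Real.sin x) =
      ∫ x in (0 : ℝ)..π, Real.cos x ^ 2 * Real.cos (ω * Real.sin x) := by
    have := hper.intervalIntegral_add_eq (-π) 0
    simp only [neg_add_cancel, zero_add] at this
    exact this
  have h3 : ∫ x in (0 : ℝ)..π, Real.cos x ^ 2 * Real.cos (ω * Real.sin x) =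
      ∫ θ in (0 : ℝ)..π, Real.cos (ω * Real.cos θ) * Real.sin θ ^ 2 := by
    have e1 : (fun x : ℝ => Real.cos x ^ 2 * Real.cos (ω * Real.sin x)) =
        fun x => (fun θ : ℝ => Real.cos (ω * Real.cos θ) * Real.sin θ ^ 2) (x + π / 2) := by
      funext x
      simp only [Real.sin_add_pi_div_two, Real.cos_add_pi_div_two, mul_neg, Real.cos_neg]
      ring
    rw [e1, intervalIntegral.integral_comp_add_right
      (fun θ : ℝ => Real.cos (ω * Real.cos θ) * Real.sin θ ^ 2) (π / 2)]
    have := hper'.intervalIntegral_add_eq (π / 2) 0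
    rw [zero_add] at this
    convert this using 2 <;> ring
  rw [h1, h2, h3, ← two_mul, mul_left_comm,
    mul_integral_cos_mul_cos_mul_sin_sq_eq_pi_mul_besselJ_one ω]
  ring

/-- `∫_{-π}^{π} cos k cos(ω sin k) dk = 0` (the integrand is the derivative of
`sin(ω sin k)/ω`; for `ω = 0` it is `∫ cos = 0`). Used for `∫ ρ₀ = 1`. [folklore] -/
theorem integral_cos_mul_cos_mul_sin (ω : ℝ) :
    ∫ x in (-π)..π, Real.cos x * Real.cos (ω * Real.sin x) = 0 := by
  rcases eq_or_ne ω 0 with rfl | hω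
  · simp [integral_cos]
  · have hderiv : ∀ x ∈ uIcc (-π) π,
        HasDerivAt (fun x => Real.sin (ω * Real.sin x)) (ω * (Real.cos x * Real.cos (ω * Real.sin x))) x := by
      intro x _
      have h := ((Real.hasDerivAt_sin x).const_mul ω).sin
      convert h using 1
      ring
    have hint : IntervalIntegrable (fun x => ω * (Real.cos x * Real.cos (ω * Real.sin x))) volume (-π) π :=
      (by fun_prop : Continuous fun x => ω * (Real.cos x * Real.cos (ω * Real.sin x))).intervalIntegrable _ _
    have h := integral_eq_sub_of_hasDerivAt hderiv hint
    simp only [Real.sin_neg, Real.sin_pi, neg_zero, mul_zero, Real.sin_zero, sub_self,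
      intervalIntegral.integral_const_mul, mul_eq_zero] at h
    exact h.resolve_left hω

/-! ### Domination and Fubini for the `ρ₀` integrand -/

/-- The `ρ₀` integrand is jointly continuous in `(k, ω)`. [folklore] -/
theorem continuous_liebWuRho0Integrand (U : ℝ) :
    Continuous fun p : ℝ × ℝ => liebWuRho0Integrand U p.1 p.2 := by
  have hJ : Continuous (besselJ 0) := continuous_besselJ_holds 0
  unfold liebWuRho0Integrand
  exact Continuous.div (by fun_prop) (by fun_prop) fun p => by positivity

/-- Domination: `|cos(ω sin k) J₀(ω)/(1 + e^{ωU/2})| ≤ e^{-(U/2) ω}` for all real `U, k, ω`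
(`|J₀| ≤ 1`, DLMF 10.14.1, and `1/(1 + e^{a}) ≤ e^{-a}`). [folklore] -/
theorem abs_liebWuRho0Integrand_le (U k ω : ℝ) :
    |liebWuRho0Integrand U k ω| ≤ Real.exp (-(U / 2) * ω) := by
  have hJ0 := abs_besselJ_zero_le_one_holds ω
  have hden : 0 < 1 + Real.exp (ω * U / 2) := by positivity
  have hexp : Real.exp (-(U / 2) * ω) * Real.exp (ω * U / 2) = 1 := by
    rw [← Real.exp_add]
    convert Real.exp_zero using 2
    ring
  rw [liebWuRho0Integrand, abs_div, abs_mul, abs_of_pos hden, div_le_iff₀ hden]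
  calc |Real.cos (ω * Real.sin k)| * |besselJ 0 ω| ≤ 1 * 1 :=
        mul_le_mul (Real.abs_cos_le_one _) hJ0 (abs_nonneg _) zero_le_one
    _ = 1 := one_mul _
    _ ≤ 1 + Real.exp (-(U / 2) * ω) := le_add_of_nonneg_right (by positivity)
    _ = Real.exp (-(U / 2) * ω) * (1 + Real.exp (ω * U / 2)) := by linear_combination -hexp

/-- For `U > 0` the `ρ₀` integrand is integrable on `(0, ∞)` (dominated by `e^{-(U/2)ω}`), so no
junk value arises in `liebWuRho0`. Lieb–Wu, Physica A 321 (2003) 1, §6. [folklore] -/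
theorem integrableOn_liebWuRho0Integrand {U : ℝ} (hU : 0 < U) (k : ℝ) :
    IntegrableOn (liebWuRho0Integrand U k) (Ioi 0) := by
  have hdom : IntegrableOn (fun ω => Real.exp (-(U / 2) * ω)) (Ioi 0) :=
    exp_neg_integrableOn_Ioi 0 (by positivity)
  refine Integrable.mono' hdom ?_ (Filter.Eventually.of_forall fun ω => ?_)
  · exact ((continuous_liebWuRho0Integrand U).comp
      (Continuous.prodMk continuous_const continuous_id)).aestronglyMeasurable
  · rw [Real.norm_eq_abs]
    exact abs_liebWuRho0Integrand_le U k ω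

/-- Fubini integrability: for `U > 0` and a continuous weight `|w| ≤ 1`, the function
`(k, ω) ↦ w(k) · cos(ω sin k) J₀(ω)/(1 + e^{ωU/2})` is integrable on `Ι a b × (0, ∞)` (dominated
by `e^{-(U/2)ω}` on a set of finite `k`-measure). [folklore] -/
theorem integrable_prod_mul_liebWuRho0Integrand {U : ℝ} (hU : 0 < U) (a b : ℝ) {w : ℝ → ℝ}
    (hw : Continuous w) (hw1 : ∀ x, |w x| ≤ 1) :
    Integrable (Function.uncurry fun x ω => w x * liebWuRho0Integrand U x ω)
      ((volume.restrict (Set.uIoc a b)).prod (volume.restrict (Ioi (0 : ℝ)))) := by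
  haveI : IsFiniteMeasure (volume.restrict (Set.uIoc a b)) := by
    refine isFiniteMeasure_restrict.2 ?_
    simp [Set.uIoc, Real.volume_Ioc]
  have hg : Integrable (fun z : ℝ × ℝ => (1 : ℝ) * Real.exp (-(U / 2) * z.2))
      ((volume.restrict (Set.uIoc a b)).prod (volume.restrict (Ioi (0 : ℝ)))) :=
    Integrable.mul_prod (integrable_const 1) (exp_neg_integrableOn_Ioi 0 (by positivity))
  refine hg.mono' ?_ (Filter.Eventually.of_forall fun z => ?_)
  · exact ((hw.comp continuous_fst).mul (continuous_liebWuRho0Integrand U)).aestronglyMeasurable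
  · rw [Function.uncurry_apply_pair, Real.norm_eq_abs, abs_mul, one_mul]
    calc |w z.1| * |liebWuRho0Integrand U z.1 z.2| ≤ 1 * Real.exp (-(U / 2) * z.2) :=
          mul_le_mul (hw1 _) (abs_liebWuRho0Integrand_le U z.1 z.2) (abs_nonneg _) zero_le_one
      _ = Real.exp (-(U / 2) * z.2) := one_mul _

/-- Fubini for the `ρ₀` integrand against a continuous weight `|w| ≤ 1` on `[-π, π] × (0, ∞)`:
`∫_{-π}^{π} w(k) (∫₀^∞ I(k, ω) dω) dk = ∫₀^∞ (∫_{-π}^{π} w(k) I(k, ω) dk) dω`, and the `k`-integrand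
on the left is interval integrable. [folklore] -/
theorem integral_mul_integral_liebWuRho0Integrand {U : ℝ} (hU : 0 < U) {w : ℝ → ℝ}
    (hw : Continuous w) (hw1 : ∀ x, |w x| ≤ 1) :
    IntervalIntegrable (fun x => w x * ∫ ω in Ioi (0 : ℝ), liebWuRho0Integrand U x ω) volume (-π) π ∧
      ∫ x in (-π)..π, w x * ∫ ω in Ioi (0 : ℝ), liebWuRho0Integrand U x ω =
        ∫ ω in Ioi (0 : ℝ), ∫ x in (-π)..π, w x * liebWuRho0Integrand U x ω := by
  have hF := integrable_prod_mul_liebWuRho0Integrand hU (-π) π hw hw1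
  have hpt : ∀ x, w x * ∫ ω in Ioi (0 : ℝ), liebWuRho0Integrand U x ω =
      ∫ ω in Ioi (0 : ℝ), w x * liebWuRho0Integrand U x ω := fun x =>
    (MeasureTheory.integral_const_mul (w x) _).symm
  refine ⟨?_, ?_⟩
  · rw [intervalIntegrable_iff]
    have h := hF.integral_prod_left
    refine (integrableOn_congr_fun (fun x _ => hpt x) measurableSet_uIoc).2 ?_
    exact h
  · simp_rw [hpt]
    exact MeasureTheory.intervalIntegral_integral_swap hF

/-! ### F3c: the energy and the normalisation of `ρ₀` (Lieb–Wu 2003, §6) -/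

/-- `∫_{-π}^{π} cos k ρ₀(k) dk = 2 ∫₀^∞ J₀(ω) J₁(ω) / (ω (1 + e^{ωU/2})) dω` for `U > 0` (the
substitution of `ρ₀` into `E = -2 N_a ∫ ρ cos k`, Fubini, and
`ω ∫_{-π}^{π} cos²k cos(ω sin k) dk = 2π J₁(ω)`). Lieb–Wu, Physica A 321 (2003) 1, §6 (boxed
formula for `E₀(N_a/2, N_a/2)`); PRL 20 (1968) 1445, eqs. (17), (19), (20).
[cite: LiebWuPhysicaA2003, §6, formula for E₀(N_a/2,N_a/2)] -/
theorem integral_cos_mul_liebWuRho0 {U : ℝ} (hU : 0 < U) :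
    ∫ x in (-π)..π, Real.cos x * liebWuRho0 U x =
      2 * ∫ ω in Ioi (0 : ℝ), liebWuEnergyIntegrand U ω := by
  -- `cos k ρ₀(k) = cos k/(2π) + π⁻¹ · cos²k ∫ I(k, ω) dω`
  have hpt : ∀ x, Real.cos x * liebWuRho0 U x =
      Real.cos x / (2 * π) + π⁻¹ * (Real.cos x ^ 2 * ∫ ω in Ioi (0 : ℝ), liebWuRho0Integrand U x ω) := by
    intro x
    rw [liebWuRho0]
    ring
  have hw1 : ∀ x, |Real.cos x ^ 2| ≤ 1 := fun x => by
    rw [abs_of_nonneg (sq_nonneg _), sq_le_one_iff_abs_le_one]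
    exact Real.abs_cos_le_one x
  obtain ⟨hint, hswap⟩ := integral_mul_integral_liebWuRho0Integrand hU (w := fun x => Real.cos x ^ 2)
    (by fun_prop) hw1
  have hcos : IntervalIntegrable (fun x => Real.cos x / (2 * π)) volume (-π) π :=
    (by fun_prop : Continuous fun x => Real.cos x / (2 * π)).intervalIntegrable _ _
  simp_rw [hpt]
  rw [intervalIntegral.integral_add hcos (hint.const_mul _), intervalIntegral.integral_const_mul,
    intervalIntegral.integral_div, integral_cos, hswap]
  -- the inner `k`-integral at fixed `ω > 0`
  have hinner : ∀ ω ∈ Ioi (0 : ℝ), ∫ x in (-π)..π, Real.cos x ^ 2 * liebWuRho0Integrand U x ω =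
      2 * π * liebWuEnergyIntegrand U ω := by
    intro ω hω
    have hω : (0 : ℝ) < ω := hω
    have e1 : (fun x => Real.cos x ^ 2 * liebWuRho0Integrand U x ω) = fun x =>
        besselJ 0 ω / (1 + Real.exp (ω * U / 2)) * (Real.cos x ^ 2 * Real.cos (ω * Real.sin x)) := by
      funext x
      rw [liebWuRho0Integrand]
      ring
    have e2 : ∫ x in (-π)..π, Real.cos x ^ 2 * Real.cos (ω * Real.sin x) = 2 * π * besselJ 1 ω / ω := by
      rw [eq_div_iff hω.ne', mul_comm]
      exact mul_integral_cos_sq_mul_cos_mul_sin ω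
    rw [e1, intervalIntegral.integral_const_mul, e2, liebWuEnergyIntegrand]
    field_simp
  rw [setIntegral_congr_fun measurableSet_Ioi hinner, MeasureTheory.integral_const_mul]
  simp only [Real.sin_neg, Real.sin_pi, neg_zero, sub_self, zero_div, zero_add]
  field_simp

/-- **F3c (Lieb–Wu 2003, §6, boxed `E₀`).** For `U > 0` the Lieb–Wu energy per site is the
`cos`-moment of the momentum density: `liebWuEnergy U = -2 ∫_{-π}^{π} ρ₀(k) cos k dk`
(`= -4 ∫₀^∞ J₀J₁/(ω(1 + e^{ωU/2}))`). Lieb–Wu, Physica A 321 (2003) 1, §4 (`E(M,M') =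
-2N_a ∫ρ cos k`) and §6 (boxed `E₀(N_a/2,N_a/2)`); PRL 20 (1968) 1445, eqs. (17), (20).
[cite: LiebWuPhysicaA2003, §6, formula for E₀(N_a/2,N_a/2)] -/
theorem liebWuEnergy_eq_integral_cos_mul_liebWuRho0 {U : ℝ} (hU : 0 < U) :
    liebWuEnergy U = -2 * ∫ x in (-π)..π, Real.cos x * liebWuRho0 U x := by
  rw [integral_cos_mul_liebWuRho0 hU, liebWuEnergy]
  ring

/-- **Normalisation of `ρ₀`**: `∫_{-π}^{π} ρ₀(k) dk = 1` for `U > 0` (`N/N_a = 1` at `Q = π`: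
the `cos k`-term integrates to zero against `cos(ω sin k)`). Lieb–Wu, Physica A 321 (2003) 1,
§5, proof of Theorem 3. [cite: LiebWuPhysicaA2003, §5, Theorem 3] -/
theorem integral_liebWuRho0 {U : ℝ} (hU : 0 < U) : ∫ x in (-π)..π, liebWuRho0 U x = 1 := by
  have hpt : ∀ x, liebWuRho0 U x =
      1 / (2 * π) + π⁻¹ * (Real.cos x * ∫ ω in Ioi (0 : ℝ), liebWuRho0Integrand U x ω) := by
    intro x
    rw [liebWuRho0]
    ring
  obtain ⟨hint, hswap⟩ := integral_mul_integral_liebWuRho0Integrand hU (w := Real.cos)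
    Real.continuous_cos Real.abs_cos_le_one
  have hinner : ∀ ω ∈ Ioi (0 : ℝ), ∫ x in (-π)..π, Real.cos x * liebWuRho0Integrand U x ω = 0 := by
    intro ω _
    have e1 : (fun x => Real.cos x * liebWuRho0Integrand U x ω) = fun x =>
        besselJ 0 ω / (1 + Real.exp (ω * U / 2)) * (Real.cos x * Real.cos (ω * Real.sin x)) := by
      funext x
      rw [liebWuRho0Integrand]
      ring
    rw [e1, intervalIntegral.integral_const_mul, integral_cos_mul_cos_mul_sin, mul_zero]
  simp_rw [hpt]
  rw [intervalIntegral.integral_add intervalIntegrable_const (hint.const_mul _),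
    intervalIntegral.integral_const_mul, intervalIntegral.integral_const, hswap,
    setIntegral_congr_fun measurableSet_Ioi hinner, integral_zero, mul_zero, add_zero, smul_eq_mul]
  have hπ : (π : ℝ) ≠ 0 := Real.pi_ne_zero
  field_simp
  ring

/-! ### Glue: F3a → F3, and the assembly of `lieb_wu` -/

/-- **F3a → F3.** If the empirical distribution of the ground-state momenta converges to
`ρ₀(k) dk` (Goldbaum 2005, (5.16)), then the Bethe energies per site
`-2 (1/N_a) Σ_j cos k_j` converge to `-2 ∫_{-π}^{π} ρ₀ cos k = liebWuEnergy U` (test F3a against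
`cos` and use F3c). Goldbaum, CMP 258 (2005) 317, §5 ("which yield the ground state energy");
Lieb–Wu, Physica A 321 (2003) 1, §6. [cite: Goldbaum2005, §5, eq. (5.16)] [cite: LiebWuPhysicaA2003, §6] -/
theorem liebWu_betheEnergy_tendsto_of_rootDensity (h : goldbaum_rootDensity_tendsto) :
    liebWu_betheEnergy_tendsto := by
  intro U hU k Λ hk
  have hlim := (h U hU k Λ hk Real.cos Real.continuous_cos).const_mul (-2)
  rw [← liebWuEnergy_eq_integral_cos_mul_liebWuRho0 hU] at hlim
  refine hlim.congr fun m => ?_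
  rw [betheEnergy]
  ring

/-- **`lieb_wu` from F2c, F3a and F5b** (F1, F4, F5a, F2c → F2′ and F3a → F3 being proved): the
Bethe state is the ground state of its sector on the rings of `4m + 2 ≥ 6` sites (F2c, Goldbaum
2005 §4), the momenta of the ground-state roots distribute according to `ρ₀` (F3a, Goldbaum
2005 §5), and `E(2n) - E(2n-1) → μ₋(U)` (F5b, Lieb–Wu 1968 eq. (23) / 2003 §7, no printed
proof). [cite: LiebWuPRL1968, eqs. (17)–(23)] [cite: Goldbaum2005, §§4–5] [cite: LiebWuPhysicaA2003, §§6–7] -/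
theorem lieb_wu_of_rootDensity (h₂ : liebWu_minEnergyOn_szSector_eq_betheEnergy)
    (h₃ : goldbaum_rootDensity_tendsto) (h₆ : liebWu_muMinus_tendsto) : lieb_wu :=
  lieb_wu_of_goldbaum' h₂ (liebWu_betheEnergy_tendsto_of_rootDensity h₃) h₆

end Literature.MathematicalPhysics.QuantumLattice
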